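import Literature.AlgebraicGeometry.GroupSchemes.WeilGluingStepStrictLaw
import Literature.AlgebraicGeometry.GroupSchemes.WeilGluingStep
import Literature.AlgebraicGeometry.GroupSchemes.BirationalGroupLawTranslate
import Literature.AlgebraicGeometry.GroupSchemes.BirationalGroupLawLeftTranslate
import Literature.AlgebraicGeometry.GroupSchemes.BirationalGroupLawTranslateGraphClosed
import Literature.AlgebraicGeometry.GroupSchemes.BirationalGroupLawMeasureStep
import Literature.AlgebraicGeometry.GroupSchemes.WeilGluingStepMeasureIncrease
import Literature.AlgebraicGeometry.GroupSchemes.BirationalGroupLawMaximal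
import Literature.AlgebraicGeometry.GroupSchemes.StrictOpenChunkInstances
import Literature.AlgebraicGeometry.GroupSchemes.BirationalGroupLawFromShears
import Literature.AlgebraicGeometry.GroupSchemes.DenseSectionsAlongFibrewiseDense
import Literature.AlgebraicGeometry.Morphisms.GeometricallyIrreducibleOfTwoCharts
import Mathlib.RingTheory.DiscreteValuationRing.Basic
import HarnessLib

/-!
# Weil's gluing step `V′ ↦ V′ ∪ V′_s` as one theorem
# (Artin, *Néron models*, §2, Lemma 2.4 and the proof of Thm. (1.12): «replacing `V′` by `V′ ∪ V′_s` increases `V′` and `W`»)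

Topic `Literature/AlgebraicGeometry/GroupSchemes`, namespace `Literature.AlgebraicGeometry.GroupSchemes`.
KERNEL ONLY: one theorem; no definition, no named fact, no instance, no `sorry`.  Cell `hodgecm-mathlib` (D-0151),
road W (Néron capital): the STEP (G2) of the W1c design (`A-provers/A-p06/W1c-DESIGN.A-p06g5.md`, probe
`W1cProbe-v6` text `StageStep` with `IsStage` unbundled), assembled from the cell's leaves:
(G0b) maximalisation ★ `BirationalGroupLaw.exists_isStrict_maximal` (A-p13) → the section `s ≫ j` of the stage and
its slices → (G1) right translate ★ `BirationalGroupLaw.exists_rightTranslate'` (B-p21), left translate by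
★ `BirationalGroupLaw.isOpenImmersion_sliceLift_comp_mul` (A-p13) → `W_s` closed ★
`BirationalGroupLaw.isClosed_range_graph_rightTranslate` (A-p13) → gluing ★ `exists_selfGluing` and
★ `isPreirreducible_fibre_of_selfGluing` (A-p06) → geometric irreducibility of the glued scheme ★
`Morphisms.geometricallyIrreducible_of_isOpenImmersion_pair` (A-p01) → dense sections of the stage ★
`forall_exists_section_mem_of_isFibrewiseDense_range` (B-p13) → (G2b) the STRICT law on the glued scheme ★
`exists_isStrict_weilGluingStep` (A-p06) → (G2c) measure increase ★ `measure_lt_measure_comp_of_mem` (B-p20) with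
★ `BirationalGroupLaw.sectionSlice_mem_domain_comp` (B-p15).

`weilGluing_stageStep`: for a strict birational group law `L` on a smooth separated quasi-compact `𝒳 → Spec R`
(discrete valuation ring `R`) with geometrically irreducible fibres and sections dense in every fibre, a STAGE
(`𝒱` smooth separated quasi-compact geometrically irreducible, `j : 𝒳 ↪ 𝒱` open immersion over `S` with
fibrewise-dense image, a strict law `L′` on `𝒱` extending `L` along `j`) and a section `s` of `𝒳` with a point `x`
at which `(a, b) ↦ j(a b)` is NOT defined at `(x, s)`: there is a new stage `(𝒲, j″, L″)` whose measure (the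
domain of definition of `(a, b) ↦ j″(a b)` in `𝒳 ×_S 𝒳`, Artin's `W`) is STRICTLY larger.
[Artin1986NeronModels] M. Artin, *Néron models*, in Cornell–Silverman, *Arithmetic Geometry* (1986), §2, pp. 221–223
(held: `book:cornellnd-arithmetic-geometry` p0292–p0294).  HC_CM is not proved here; nothing here changes the floor.

## References
* [Artin1986NeronModels] M. Artin, *Néron models*, in *Arithmetic Geometry* (Cornell, Silverman eds.), Springer 1986, §2.
* [EdixhovenRomagny] B. Edixhoven, M. Romagny, *Group schemes out of birational group laws, Néron models*, Panor. Synthèses 47 (2015), §3.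
* [BLRNeronModels1990] S. Bosch, W. Lütkebohmert, M. Raynaud, *Néron Models*, Springer 1990, §5.1–5.2.
-/

noncomputable section

namespace Literature.AlgebraicGeometry.GroupSchemes

open CategoryTheory CategoryTheory.Limits _root_.AlgebraicGeometry MonoidalCategory CartesianMonoidalCategory
  TopologicalSpace
open scoped CategoryTheory.Obj

universe u

/-- **Weil's gluing step `V′ ↦ V′ ∪ V′_s`** ([Artin1986NeronModels] §2, Lemma 2.4 «`V` is dense in each fibre of
`V′`, and `V′` has property (2.2)» and p. 222 «replacing `V′` by `V′ ∪ V′_s` increases `V′` and `W`»): see the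
module docstring for the chain of leaves.  Hypotheses: the stage `(𝒱, j, L′)` of `(𝒳, L)` (instance binders +
`hjd`, `hL′`, `φ`), a section `s` of `𝒳` and a point `x` with `σ_s(x) = (x, s(πx))` outside the measure of the
stage; conclusion: a stage `(𝒲, j″, L″)` with strictly larger measure.
[cite: Artin1986NeronModels, §2 Lemma 2.4 and proof of Thm. (1.12) (pp. 222–223)] [cite: EdixhovenRomagny, Thm. 3.18]
[cite: BLRNeronModels1990, §5.1 Thm. 5] -/
theorem weilGluing_stageStep
    (R : Type u) [CommRing R] [IsDomain R] [IsDiscreteValuationRing R]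
    (𝒳 : Over (Spec (.of R))) [Smooth 𝒳.hom] [IsSeparated 𝒳.hom] [QuasiCompact 𝒳.hom]
    [GeometricallyIrreducible 𝒳.hom]
    (hsec : ∀ (x : 𝒳.left) (Ω : 𝒳.left.Opens), x ∈ Ω →
      ∃ a : Spec (.of R) ⟶ 𝒳.left, a ≫ 𝒳.hom = 𝟙 _ ∧ ∃ t : Spec (.of R), a.base t ∈ Ω ∧ 𝒳.hom.base (a.base t) = 𝒳.hom.base x)
    (L : BirationalGroupLaw 𝒳) (hL : L.IsStrict)
    (𝒱 : Over (Spec (.of R))) (j : 𝒳 ⟶ 𝒱) (L' : BirationalGroupLaw 𝒱)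
    [hsm : Smooth 𝒱.hom] [hsep : IsSeparated 𝒱.hom] [hqc : QuasiCompact 𝒱.hom] [hgi : GeometricallyIrreducible 𝒱.hom]
    [hj : IsOpenImmersion j.left] (hjd : IsFibrewiseDense 𝒱.hom (Set.range j.left.base)) (hL' : L'.IsStrict)
    (φ : (L.dom : Scheme.{u}) ⟶ (L'.dom : Scheme.{u})) (hφ₁ : φ ≫ L'.dom.ι = L.dom.ι ≫ (j ⊗ₘ j).left)
    (hφ₂ : φ ≫ L'.mul = L.mul ≫ j.left)
    (s : Spec (.of R) ⟶ 𝒳.left) (hs : s ≫ 𝒳.hom = 𝟙 _) (x : 𝒳.left)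
    (hx : (lift (𝟙 𝒳) (Over.homMk (𝒳.hom ≫ s) (by rw [Category.assoc, hs, Category.comp_id]) : 𝒳 ⟶ 𝒳)).left.base x
        ∉ (Scheme.PartialMap.toRationalMap
          (⟨L.dom, L.dense_dom.dense, L.mul ≫ j.left⟩ : Scheme.PartialMap (𝒳 ⊗ 𝒳).left 𝒱.left)).domain) :
    ∃ (𝒲 : Over (Spec (.of R))) (j'' : 𝒳 ⟶ 𝒲) (L'' : BirationalGroupLaw 𝒲),
      Smooth 𝒲.hom ∧ IsSeparated 𝒲.hom ∧ QuasiCompact 𝒲.hom ∧ GeometricallyIrreducible 𝒲.hom ∧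
      IsOpenImmersion j''.left ∧ IsFibrewiseDense 𝒲.hom (Set.range j''.left.base) ∧ L''.IsStrict ∧
      (∃ φ'' : (L.dom : Scheme.{u}) ⟶ (L''.dom : Scheme.{u}),
        φ'' ≫ L''.dom.ι = L.dom.ι ≫ (j'' ⊗ₘ j'').left ∧ φ'' ≫ L''.mul = L.mul ≫ j''.left) ∧
      (Scheme.PartialMap.toRationalMap
          (⟨L.dom, L.dense_dom.dense, L.mul ≫ j.left⟩ : Scheme.PartialMap (𝒳 ⊗ 𝒳).left 𝒱.left)).domain <
        (Scheme.PartialMap.toRationalMap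
          (⟨L.dom, L.dense_dom.dense, L.mul ≫ j''.left⟩ : Scheme.PartialMap (𝒳 ⊗ 𝒳).left 𝒲.left)).domain := by
  haveI := hsm; haveI := hsep; haveI := hqc; haveI := hgi; haveI := hj
  -- standing instances on `𝒳` and `𝒱`
  haveI : Smooth (𝒳 ⊗ 𝒳).hom := Literature.NumberTheory.EllipticCurves.smooth_tensorObj_hom_of_smooth ‹_› ‹_›
  haveI : GeometricallyIrreducible (𝒳 ⊗ 𝒳).hom := geometricallyIrreducible_tensorObj_hom 𝒳
  haveI : IsIntegral (𝒳 ⊗ 𝒳).left := isIntegral_left_of_smooth_of_geometricallyIrreducible (𝒳 ⊗ 𝒳)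
  have hirrX : ∀ t : Spec (.of R), IsPreirreducible (𝒳.hom.base ⁻¹' {t}) := fun t =>
    (𝒳.hom.isIrreducible_preimage 𝒳.hom.isOpenMap isIrreducible_singleton).isPreirreducible
  haveI : IsIntegral 𝒱.left := isIntegral_left_of_smooth_of_geometricallyIrreducible 𝒱
  haveI : Smooth (𝒱 ⊗ 𝒱).hom := Literature.NumberTheory.EllipticCurves.smooth_tensorObj_hom_of_smooth hsm hsm
  haveI : GeometricallyIrreducible (𝒱 ⊗ 𝒱).hom := geometricallyIrreducible_tensorObj_hom 𝒱
  haveI : IsIntegral (𝒱 ⊗ 𝒱).left := isIntegral_left_of_smooth_of_geometricallyIrreducible (𝒱 ⊗ 𝒱)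
  haveI : (Spec (.of R)).IsSeparated := inferInstance
  haveI : CompactSpace 𝒱.left := QuasiCompact.compactSpace_of_compactSpace 𝒱.hom
  have hirrV : ∀ t : Spec (.of R), IsPreirreducible (𝒱.hom.base ⁻¹' {t}) := fun t =>
    (𝒱.hom.isIrreducible_preimage 𝒱.hom.isOpenMap isIrreducible_singleton).isPreirreducible
  have hVfst : ∀ v : 𝒱.left, IsPreirreducible ((fst 𝒱 𝒱).left.base ⁻¹' {v}) := fun v =>
    ((pullback.fst 𝒱.hom 𝒱.hom).isIrreducible_preimage (pullback.fst 𝒱.hom 𝒱.hom).isOpenMap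
      isIrreducible_singleton).isPreirreducible
  haveI : QuasiCompact (fst 𝒱 𝒱).left := by change QuasiCompact (pullback.fst 𝒱.hom 𝒱.hom); infer_instance
  haveI : QuasiCompact (𝒱 ⊗ 𝒱).hom := by rw [← Over.w (fst 𝒱 𝒱)]; infer_instance
  haveI : IsLocallyNoetherian (𝒱 ⊗ 𝒱).left := LocallyOfFiniteType.isLocallyNoetherian (𝒱 ⊗ 𝒱).hom
  haveI : CompactSpace ↑(𝒱 ⊗ 𝒱).left := QuasiCompact.compactSpace_of_compactSpace (𝒱 ⊗ 𝒱).hom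
  haveI : IsNoetherian (𝒱 ⊗ 𝒱).left := {}
  haveI : NoetherianSpace ↑(𝒱 ⊗ 𝒱).left := inferInstance
  haveI : NoetherianSpace (L'.dom : Scheme.{u}) := inferInstanceAs (NoetherianSpace (L'.dom : Set ↑(𝒱 ⊗ 𝒱).left))
  haveI : Smooth ((𝒱 ⊗ 𝒱) ⊗ 𝒱).hom :=
    Literature.NumberTheory.EllipticCurves.smooth_tensorObj_hom_of_smooth inferInstance hsm
  haveI : GeometricallyIrreducible ((𝒱 ⊗ 𝒱) ⊗ 𝒱).hom := by
    rw [Over.tensorObj_hom]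
    exact @GeometricallyIrreducible.comp _ _ _ (pullback.fst (𝒱 ⊗ 𝒱).hom 𝒱.hom) (𝒱 ⊗ 𝒱).hom
      (MorphismProperty.pullback_fst _ _ inferInstance) inferInstance
      (MorphismProperty.pullback_fst _ _ inferInstance) inferInstance
  haveI : IsIntegral ((𝒱 ⊗ 𝒱) ⊗ 𝒱).left := isIntegral_left_of_smooth_of_geometricallyIrreducible ((𝒱 ⊗ 𝒱) ⊗ 𝒱)
  -- dense sections of the stage
  have hsecV := forall_exists_section_mem_of_isFibrewiseDense_range j hjd hsec
  -- (G0b) maximalise the law of the stage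
  obtain ⟨Lm, hLm, -, ⟨hle', hLmmul⟩, hmax⟩ := L'.exists_isStrict_maximal hL' hsecV
  haveI : NoetherianSpace (Lm.dom : Scheme.{u}) := inferInstanceAs (NoetherianSpace (Lm.dom : Set ↑(𝒱 ⊗ 𝒱).left))
  -- the section `s' = s ≫ j` of `𝒱` and its two slice embeddings (pullback-lift form)
  let s' : Spec (.of R) ⟶ 𝒱.left := s ≫ j.left
  have hs' : s' ≫ 𝒱.hom = 𝟙 _ := by rw [Category.assoc, Over.w j, hs]
  let σ : 𝒱.left ⟶ (𝒱 ⊗ 𝒱).left := pullback.lift (𝟙 𝒱.left) (𝒱.hom ≫ s')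
    (by rw [Category.assoc, hs', Category.comp_id, Category.id_comp])
  have hσ₁ : σ ≫ (fst 𝒱 𝒱).left = 𝟙 _ := pullback.lift_fst _ _ _
  have hσ₂ : σ ≫ (snd 𝒱 𝒱).left = 𝒱.hom ≫ s' := pullback.lift_snd _ _ _
  let σ' : 𝒱.left ⟶ (𝒱 ⊗ 𝒱).left := pullback.lift (𝒱.hom ≫ s') (𝟙 𝒱.left)
    (by rw [Category.assoc, hs', Category.comp_id, Category.id_comp])
  have hσ'₁ : σ' ≫ (fst 𝒱 𝒱).left = 𝒱.hom ≫ s' := pullback.lift_fst _ _ _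
  have hσ'₂ : σ' ≫ (snd 𝒱 𝒱).left = 𝟙 _ := pullback.lift_snd _ _ _
  -- (G1) the right translate chart of `Lm` at `s'` (★ B-p21 `exists_rightTranslate'`, Over-form slice ⇒ convert)
  obtain ⟨A, e, ρ, heO, hρe, hρo, hρS, hAiff, -, -, hdens⟩ := Lm.exists_rightTranslate' s' hs'
  have hσO : (lift (𝟙 𝒱) (Over.homMk (𝒱.hom ≫ s') (by rw [Category.assoc, hs', Category.comp_id]) : 𝒱 ⟶ 𝒱)).left
      = σ := by
    apply pullback.hom_ext
    · rw [pullback.lift_fst]; exact congrArg CommaMorphism.left (lift_fst (𝟙 𝒱) _)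
    · rw [pullback.lift_snd]; exact congrArg CommaMorphism.left (lift_snd (𝟙 𝒱) _)
  have he : e ≫ Lm.dom.ι = A.ι ≫ σ := by rw [heO, hσO]
  have hAiff' : ∀ a : 𝒱.left, a ∈ A ↔ σ.base a ∈ Lm.dom := fun a => by rw [← hσO]; exact hAiff a
  subst hρe
  haveI : IsOpenImmersion (e ≫ Lm.mul) := hρo
  obtain ⟨hAd, hρd⟩ := hdens hLm hirrV
  -- the left translate chart of `Lm` at `s'`: `A' = σ'⁻¹ dom`, `el` the lift (★ A-p13 §3 for the open immersion)
  let A' : 𝒱.left.Opens := σ' ⁻¹ᵁ Lm.dom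
  have rA' : Set.range (A'.ι ≫ σ').base ⊆ Set.range Lm.dom.ι.base := by
    rintro _ ⟨a, rfl⟩
    rw [Scheme.Opens.range_ι]
    have : A'.ι.base a ∈ A' := by rw [← SetLike.mem_coe, ← Scheme.Opens.range_ι]; exact ⟨a, rfl⟩
    exact this
  obtain ⟨el, hel⟩ : ∃ el : (A' : Scheme.{u}) ⟶ (Lm.dom : Scheme.{u}), el ≫ Lm.dom.ι = A'.ι ≫ σ' :=
    ⟨IsOpenImmersion.lift Lm.dom.ι (A'.ι ≫ σ') rA', IsOpenImmersion.lift_fac _ _ _⟩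
  have hlo : IsOpenImmersion (el ≫ Lm.mul) :=
    BirationalGroupLaw.isOpenImmersion_sliceLift_comp_mul 𝒱 s' hs' Lm A' el hel (fun a ha => ha)
  haveI := hlo
  -- densities of `A'` and of the image of the left translate (strictness of `Lm` at the points `s' t`)
  have hA'd : IsFibrewiseDense 𝒱.hom (A' : Set 𝒱.left) := by
    refine IsFibrewiseDense.of_isOpen_of_forall_nonempty A'.isOpen hirrV fun t ⟨v, hv⟩ => ?_
    obtain ⟨⟨hdf, -⟩, -, -⟩ := hLm
    have hvF : σ'.base v ∈ (fst 𝒱 𝒱).left.base ⁻¹' {s'.base t} := by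
      change ((σ' ≫ (fst 𝒱 𝒱).left)).base v = s'.base t
      rw [hσ'₁]; exact congrArg s'.base hv
    obtain ⟨w, hwdom, hwF⟩ := hdf.nonempty_inter_fibre ⟨_, hvF⟩
    obtain ⟨a, ha, hat⟩ := exists_sectionSliceLeft_eq 𝒱 s' hs' w t hwF
    refine ⟨a, ?_, hat⟩
    have hσ'O : (lift (Over.homMk (𝒱.hom ≫ s') (by rw [Category.assoc, hs', Category.comp_id]) : 𝒱 ⟶ 𝒱)
        (𝟙 𝒱)).left = σ' := sectionSliceLeft_eq_pullbackLift 𝒱 s' hs'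
    change σ'.base a ∈ Lm.dom
    rw [← hσ'O, ha]; exact hwdom
  have hld : IsFibrewiseDense 𝒱.hom (Set.range (el ≫ Lm.mul).base) := by
    refine IsFibrewiseDense.of_isOpen_of_forall_nonempty (el ≫ Lm.mul).isOpenEmbedding.isOpen_range hirrV
      fun t ht => ?_
    obtain ⟨a₀, ha₀, ha₀t⟩ := hA'd.nonempty_inter_fibre ht
    have : a₀ ∈ Set.range A'.ι.base := by rw [Scheme.Opens.range_ι]; exact ha₀
    obtain ⟨a, rfl⟩ := this
    refine ⟨(el ≫ Lm.mul).base a, ⟨a, rfl⟩, ?_⟩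
    change ((el ≫ Lm.mul) ≫ 𝒱.hom).base a = t
    rw [Category.assoc, Lm.mul_comp, ← Category.assoc, hel, Category.assoc, ← Over.w (snd 𝒱 𝒱), ← Category.assoc σ',
      hσ'₂, Category.id_comp]
    exact ha₀t
  -- `hclosed` (★ A-p13) and the gluing (★ G2a, G2a′), geometric irreducibility (G2a″)
  have hclosed := Lm.isClosed_range_graph_rightTranslate hLm hsecV hmax s' hs' A e he (fun a ha => (hAiff' a).2 ha) hρS
  obtain ⟨𝒲, i₁, i₂, ho₁, ho₂, hglue, hcover, hinter, hWsm, hWsep, hWqc⟩ := exists_selfGluing 𝒱 A (e ≫ Lm.mul) hρS hclosed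
  haveI := ho₁; haveI := ho₂; haveI := hWsm; haveI := hWsep; haveI := hWqc
  obtain ⟨hirrW, hi₁d, hi₂d⟩ := isPreirreducible_fibre_of_selfGluing 𝒱 A (e ≫ Lm.mul) i₁ i₂ hglue hcover hirrV hAd
  have hmeet : ∀ t : Spec (.of R), (𝒲.hom.base ⁻¹' {t}).Nonempty →
      (Set.range i₁.left.base ∩ Set.range i₂.left.base ∩ 𝒲.hom.base ⁻¹' {t}).Nonempty := by
    rintro t ⟨w, hw⟩
    have : w ∈ Set.range i₁.left.base ∪ Set.range i₂.left.base := by rw [hcover]; trivial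
    have hVt : (𝒱.hom.base ⁻¹' {t}).Nonempty := by
      rcases this with ⟨v, rfl⟩ | ⟨v, rfl⟩
      · exact ⟨v, by change 𝒱.hom.base v = t; rw [← Over.w i₁]; exact hw⟩
      · exact ⟨v, by change 𝒱.hom.base v = t; rw [← Over.w i₂]; exact hw⟩
    obtain ⟨a, ha, hat⟩ := hAd.nonempty_inter_fibre hVt
    refine ⟨i₂.left.base a, ?_, by change (i₂.left ≫ 𝒲.hom).base a = t; rw [Over.w i₂]; exact hat⟩
    rw [hinter]; exact ⟨a, ha, rfl⟩
  haveI hWgi : GeometricallyIrreducible 𝒲.hom :=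
    Literature.AlgebraicGeometry.Morphisms.geometricallyIrreducible_of_isOpenImmersion_pair i₁ i₂ hcover hmeet
  -- standing instances on `𝒲`
  haveI : IsIntegral 𝒲.left := isIntegral_left_of_smooth_of_geometricallyIrreducible 𝒲
  haveI : Smooth (𝒲 ⊗ 𝒲).hom := Literature.NumberTheory.EllipticCurves.smooth_tensorObj_hom_of_smooth hWsm hWsm
  haveI : GeometricallyIrreducible (𝒲 ⊗ 𝒲).hom := geometricallyIrreducible_tensorObj_hom 𝒲
  haveI : IsIntegral (𝒲 ⊗ 𝒲).left := isIntegral_left_of_smooth_of_geometricallyIrreducible (𝒲 ⊗ 𝒲)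
  haveI : Smooth ((𝒲 ⊗ 𝒲) ⊗ 𝒲).hom :=
    Literature.NumberTheory.EllipticCurves.smooth_tensorObj_hom_of_smooth inferInstance hWsm
  haveI : GeometricallyIrreducible ((𝒲 ⊗ 𝒲) ⊗ 𝒲).hom := by
    rw [Over.tensorObj_hom]
    exact @GeometricallyIrreducible.comp _ _ _ (pullback.fst (𝒲 ⊗ 𝒲).hom 𝒲.hom) (𝒲 ⊗ 𝒲).hom
      (MorphismProperty.pullback_fst _ _ inferInstance) inferInstance
      (MorphismProperty.pullback_fst _ _ inferInstance) inferInstance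
  haveI : IsIntegral ((𝒲 ⊗ 𝒲) ⊗ 𝒲).left := isIntegral_left_of_smooth_of_geometricallyIrreducible ((𝒲 ⊗ 𝒲) ⊗ 𝒲)
  haveI : 𝒲.left.IsSeparated := ⟨by
    rw [show terminal.from 𝒲.left = 𝒲.hom ≫ terminal.from _ from terminal.hom_ext _ _]; infer_instance⟩
  haveI : IsSeparated (𝒲 ⊗ 𝒲).hom := by
    rw [Over.tensorObj_hom]
    exact MorphismProperty.comp_mem _ _ _ (MorphismProperty.pullback_fst _ _ hWsep) hWsep
  haveI : (𝒲 ⊗ 𝒲).left.IsSeparated := ⟨by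
    rw [show terminal.from (𝒲 ⊗ 𝒲).left = (𝒲 ⊗ 𝒲).hom ≫ terminal.from _ from terminal.hom_ext _ _]; infer_instance⟩
  have hWfst : ∀ w : 𝒲.left, IsPreirreducible ((fst 𝒲 𝒲).left.base ⁻¹' {w}) := fun w =>
    ((pullback.fst 𝒲.hom 𝒲.hom).isIrreducible_preimage (pullback.fst 𝒲.hom 𝒲.hom).isOpenMap
      isIrreducible_singleton).isPreirreducible
  have hWsnd : ∀ w : 𝒲.left, IsPreirreducible ((snd 𝒲 𝒲).left.base ⁻¹' {w}) := fun w =>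
    ((pullback.snd 𝒲.hom 𝒲.hom).isIrreducible_preimage (pullback.snd 𝒲.hom 𝒲.hom).isOpenMap
      isIrreducible_singleton).isPreirreducible
  have hWS : ∀ t : Spec (.of R), IsPreirreducible ((𝒲 ⊗ 𝒲).hom.base ⁻¹' {t}) := fun t =>
    ((𝒲 ⊗ 𝒲).hom.isIrreducible_preimage (𝒲 ⊗ 𝒲).hom.isOpenMap isIrreducible_singleton).isPreirreducible
  -- the parameter scheme `P = 𝒱 ×_S A′` of the left chart
  have hlS : (el ≫ Lm.mul) ≫ 𝒱.hom = A'.ι ≫ 𝒱.hom := by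
    rw [Category.assoc, Lm.mul_comp, ← Category.assoc, hel, Category.assoc, ← Over.w (snd 𝒱 𝒱),
      ← Category.assoc σ', hσ'₂, Category.id_comp]
  let A'O : Over (Spec (.of R)) := Over.mk (A'.ι ≫ 𝒱.hom)
  let ι'O : A'O ⟶ 𝒱 := Over.homMk A'.ι rfl
  let lamO : A'O ⟶ 𝒱 := Over.homMk (el ≫ Lm.mul) hlS
  haveI : IsOpenImmersion ι'O.left := inferInstanceAs (IsOpenImmersion A'.ι)
  haveI : IsOpenImmersion lamO.left := inferInstanceAs (IsOpenImmersion (el ≫ Lm.mul))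
  haveI : IsOpenImmersion (𝟙 𝒱 : 𝒱 ⟶ 𝒱).left := by change IsOpenImmersion (𝟙 𝒱.left); infer_instance
  let πA : (𝒱 ⊗ A'O).left ⟶ (A' : Scheme.{u}) := (snd 𝒱 A'O).left
  let θι : (𝒱 ⊗ A'O).left ⟶ (𝒱 ⊗ 𝒱).left := (𝟙 𝒱 ⊗ₘ ι'O).left
  let θl : (𝒱 ⊗ A'O).left ⟶ (𝒱 ⊗ 𝒱).left := (𝟙 𝒱 ⊗ₘ lamO).left
  haveI : IsOpenImmersion θι := isOpenImmersion_tensorHom_left' (𝟙 𝒱) ι'O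
  haveI : IsOpenImmersion θl := isOpenImmersion_tensorHom_left' (𝟙 𝒱) lamO
  have hθι₁ : θι ≫ (fst 𝒱 𝒱).left = (fst 𝒱 A'O).left := by
    change (𝟙 𝒱 ⊗ₘ ι'O).left ≫ (fst 𝒱 𝒱).left = _; rw [tensorHom_left_fst_left']; exact Category.comp_id _
  have hθι₂ : θι ≫ (snd 𝒱 𝒱).left = πA ≫ A'.ι := tensorHom_left_snd_left' (𝟙 𝒱) ι'O
  have hθl₁ : θl ≫ (fst 𝒱 𝒱).left = (fst 𝒱 A'O).left := by
    change (𝟙 𝒱 ⊗ₘ lamO).left ≫ (fst 𝒱 𝒱).left = _; rw [tensorHom_left_fst_left']; exact Category.comp_id _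
  have hθl₂ : θl ≫ (snd 𝒱 𝒱).left = πA ≫ el ≫ Lm.mul := tensorHom_left_snd_left' (𝟙 𝒱) lamO
  have hrange : ∀ (g : A'O ⟶ 𝒱) (w : ↑(𝒱 ⊗ 𝒱).left), (snd 𝒱 𝒱).left.base w ∈ Set.range g.left.base →
      w ∈ Set.range (𝟙 𝒱 ⊗ₘ g).left.base := by
    intro g w hw
    have hr : Set.range (𝟙 𝒱 ⊗ₘ g).left.base = (pullback.fst 𝒱.hom 𝒱.hom).base ⁻¹' Set.range (𝟙 𝒱 : 𝒱 ⟶ 𝒱).left.base ∩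
        (pullback.snd 𝒱.hom 𝒱.hom).base ⁻¹' Set.range g.left.base := by
      rw [Over.tensorHom_left]; exact Scheme.Pullback.range_map _ _ _ _ _ _ _ _ _
    rw [hr]
    refine ⟨⟨(pullback.fst 𝒱.hom 𝒱.hom).base w, ?_⟩, hw⟩
    change (𝟙 𝒱.left : 𝒱.left ⟶ 𝒱.left).base ((pullback.fst 𝒱.hom 𝒱.hom).base w) = _
    rfl
  have hP : ∀ w : ↑(𝒱 ⊗ 𝒱).left, (snd 𝒱 𝒱).left.base w ∈ A' → w ∈ Set.range θι.base := fun w hw =>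
    hrange ι'O w (by change _ ∈ Set.range A'.ι.base; rw [Scheme.Opens.range_ι]; exact hw)
  have hPl : ∀ w : ↑(𝒱 ⊗ 𝒱).left, (snd 𝒱 𝒱).left.base w ∈ Set.range (el ≫ Lm.mul).base →
      w ∈ Set.range θl.base := fun w hw => hrange lamO w hw
  -- (G2b) the strict law on `𝒲`
  haveI : Nonempty 𝒱.left := inferInstance
  have hA : (A : Set 𝒱.left).Nonempty := by
    obtain ⟨a, ha, -⟩ := hAd.nonempty_inter_fibre (x := 𝒱.hom.base (Classical.arbitrary 𝒱.left)) ⟨_, rfl⟩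
    exact ⟨a, ha⟩
  obtain ⟨L'', hL'', φ'', hφ''₁, hφ''₂⟩ := exists_isStrict_weilGluingStep Lm i₁ i₂ s' σ hσ₁ hσ₂ A e he hρo hglue σ'
    hσ'₁ hσ'₂ A' el hel hlo (fst 𝒱 A'O).left πA θι θl hθι₁ hθι₂ hθl₁ hθl₂ hP hPl hA hA'd hLm hld hcover hVfst hWfst
    hWsnd hWS
  -- the new stage
  refine ⟨𝒲, j ≫ i₁, L'', hWsm, hWsep, hWqc, hWgi, ?_, ?_, hL'', ⟨φ ≫ (𝒱 ⊗ 𝒱).left.homOfLE hle' ≫ φ'', ?_, ?_⟩, ?_⟩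
  · change IsOpenImmersion (j.left ≫ i₁.left); infer_instance
  · refine IsFibrewiseDense.of_isOpen_of_forall_nonempty ?_ hirrW fun t ht => ?_
    · change IsOpen (Set.range (j.left ≫ i₁.left).base)
      exact (j.left ≫ i₁.left).isOpenEmbedding.isOpen_range
    · obtain ⟨_, ⟨v, rfl⟩, hv⟩ := hi₁d.nonempty_inter_fibre ht
      have hvt : 𝒱.hom.base v = t := by
        have : (i₁.left ≫ 𝒲.hom).base v = t := hv
        rwa [Over.w i₁] at this
      obtain ⟨_, ⟨y, rfl⟩, hy⟩ := hjd.nonempty_inter_fibre (x := t) ⟨v, hvt⟩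
      refine ⟨i₁.left.base (j.left.base y), ⟨y, rfl⟩, ?_⟩
      change (i₁.left ≫ 𝒲.hom).base (j.left.base y) = t
      rw [Over.w i₁]; exact hy
  · rw [Category.assoc, Category.assoc, hφ''₁, ← Category.assoc ((𝒱 ⊗ 𝒱).left.homOfLE hle'), Scheme.homOfLE_ι,
      reassoc_of% hφ₁, ← Over.comp_left, tensorHom_comp_tensorHom]
  · rw [Category.assoc, Category.assoc, hφ''₂, reassoc_of% hLmmul, reassoc_of% hφ₂, Over.comp_left]
  · -- (G2c) the measure increases strictly (★ B-p15 `sectionSlice_mem_domain_comp`)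
    refine measure_lt_measure_comp_of_mem L j i₁ _ hx ?_
    exact BirationalGroupLaw.sectionSlice_mem_domain_comp L Lm j hL hLm hirrX hsec hjd
      (φ ≫ (𝒱 ⊗ 𝒱).left.homOfLE hle') (by rw [Category.assoc, Scheme.homOfLE_ι, hφ₁])
      (by rw [Category.assoc, hLmmul, hφ₂]) i₁ i₂ s hs σ hσ₁ hσ₂ e (e ≫ Lm.mul) he rfl hρS
      (fun a ha => (hAiff' a).2 ha) hglue x

end Literature.AlgebraicGeometry.GroupSchemes

end
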